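import Summits.AtomisticToContinuum.BoseEinsteinCondensation.Theses.BECConjugateDomination
import Summits.AtomisticToContinuum.BoseEinsteinCondensation.Theorems.PuffFloor.Negative.PuffFloorFalseForNearMinimisers
import Literature.MathematicalPhysics.QuantumManyBody.PeriodicBoseGasThm31
import Literature.MathematicalPhysics.QuantumManyBody.PeriodicBoseGasImpurityTranslation

/-!
# Line `coupling-slope-pocket` — skeleton for the crux `BECConjugateDomination.PuffFloor`
(crux item stmt-AtomisticToContinuum-11785, rank 3, route `route-AtomisticToContinuum-BECConjugateDomination`)

Crux (FIXED, by name): `PuffFloor` — for every smooth-class `v` (repulsive finite range, finite, `C²`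
as `ṽ(x) = v(|x|)`, edge condition `‖D²ṽ‖ ≤ Cₑ√ṽ`) there are `C ≥ 0`, `ρ₀ > 0` with: for
`0 < ρ < ρ₀`, eventually in `n`, every exact, finite-energy, real, nowhere-vanishing minimiser `Ψ` of
the periodic `(n+1)`-body energy on the torus of side `L = ((n+1)/ρ)^{1/3}` has
`S_m ≥ |k|/√(|k|² + Cρ)` for every mode `m ≠ 0` (`k = 2πm/L`,
`S_m = (n+1)⁻¹ ∫ |∑ⱼ e_m(xⱼ)|² |Ψ|²`).

Idea (card `Ideas/coupling-slope-pocket.md`, triage r1-1/2/3: pass; sharpenings adopted): the ONE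
unprinted input of the printed Puff–Feynman sum-rule chain is the expectation, in the minimiser, of the
Puff pair weight `W(x) = |x|² ‖D²ṽ(x)‖` (a soft-edge pair count). The variational slope
(Hellmann–Feynman chord) of `E₀` along `H(v) − t∑W` turns it into a statement about a HAMILTONIAN:
`t₀ ⟨∑W⟩_{Ψ₀} ≤ E₀(v) − inf spec (H(v) − t₀∑W)`, and `inf spec(H(v) − t₀∑W) ≥ 0` ("the pocket
potential `v − t₀W` binds nothing") holds for a positive soft core because (i) `v − tW` is classically
stable with constant `O(t²)` — the pocket is `O(t²)`-shallow by the edge condition, and cube counting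
pays it from the core (Tier 1 of the card), and (ii) classical stability + `v(0) > 0` give quantum
non-negativity on every large torus (Lee 2009, Thm 7 — separation-free, triage-verified on
arXiv:0803.0533 pp. 5–7). With the constant trial state (`E₀ ≤ ½N²L⁻³‖ṽ‖₁`) this is Puff's
parameter `Θ = (12T + 2P)/N ≤ Cρ`, and the sharp (real-minimiser) Puff–Feynman chain gives the floor.

THE LINE (lead reshape 2026-08-16, prover-line-stmt-AtomisticToContinuum-11785-0: S3 PROVED in file,
S4 split into S4a Euler–Lagrange + S4b Puff engine; 7 registered stubs, glued by `PuffFloor_of`; `W` below always denotes the radial profile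
`r ↦ r²‖D²ṽ(r e₀)‖`, read through the tree's `interaction` / `periodicInteraction`):
* `stub_pocketClassicalStability` (S1, Tier 1 of the card; M) — classical stability of the pocket
  `v − tW` on `ℝ³`-configurations with constant `B t² N`, `0 < t ≤ t₁` (edge condition + cube count).
* `stub_noBindingOfStability` (S2, HARDEST real stub; L) — Lee 2009 Thm 7 for `V₁ = ṽ`, `V₂ = t₁W`:
  classical stability + `v(0) > 0` ⇒ `t₀ ⟨Ψ, ∑W^per Ψ⟩ ≤ ⟨Ψ, H(v)Ψ⟩` for all `N`, all `L ≥ L₀`.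
* `bornEnergyBound` (S3; PROVED in this file) — `E₀^per(n+1,L) ≤ C_E (n+1)²/L³` (constant trial state,
  `C_E = ‖ṽ‖₁`).
* `stub_eulerLagrange` (S4a; M–L) — the eigenvalue equation `−ΔΨ + V^perΨ = E₀Ψ` POINTWISE for a
  `C³` exact minimiser (first variation in the class + one integration by parts on the torus).
* `stub_puffFeynmanFloor` (S4b; L–XL) — the printed sum-rule engine, sharp real form, given the
  equation: for a `C³` real nowhere-zero minimiser, `c₁T + c₂P ≤ ΘN ⇒ S_m ≥ |k|/√(|k|²+Θ)` with
  universal numerics (`c₁ = 12`, `c₂ = 2`; f-sum, Puff's cubic moment, two Cauchy–Schwarz steps;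
  companion of sibling support stmt-12618 `CurrentSumRule`).
* `stub_positiveMinimiser` (S5; L) — route support item stmt-11787 `PositiveMinimiser` BY NAME
  (a `C³`, positive, finite-energy minimiser exists at every `(n+1, L)`); landing it also closes 11787.
* `stub_positiveMinimiserUnique` (S6; M) — two nowhere-vanishing non-negative exact minimisers
  coincide (convexity of `ρ ↦ |∇√ρ|²`; transfers the floor from the `C³` minimiser to the crux's `C¹` one).
* `stub_corelessPairMoment` (S7; SCOPE RESIDUAL, open) — the pair-moment bound `P ≤ C_P ρ N` for
  positive minimisers when `v(0) = 0` (hollow / coreless class members), for which every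
  energy-comparison lever is void (card §(iii), triage S1/F1). Recommended disposition: tenure
  restatement of the smooth class with `0 < v 0` (then S7 and the case split disappear); it is NOT the
  stub to start proving.
* `pairMoment_of_positiveCore` — PROVED here: S1 + S2 ⇒ the `ρ`-free no-binding form bound
  (the card's `PocketNoBinding`, C⁺ of its Transfer).
* `PuffFloor_of : PuffFloor` — the kernel-checked composition (no `sorry` of its own): case split on
  `0 < v 0`; slope step `t₀P ≤ E₀ ≤ C_Eρ(n+1)` resp. S7; `T ≤ E₀`; S4 at the `C³` positive minimiser of
  S5, transported to the crux's minimiser by S6; `C = 12·C_E + 2·C_P`.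

Disproof.lean (cdisprove v3/v4) honoured: (a) `puffFloor_false_without_minimality` — exact minimality
is consumed twice, in S4 (weak Euler–Lagrange equation ⇒ f-sum identity and `(H−E₀)ρ_k†Ψ = A_kΨ`) and in
S6/S7/the slope step (`periodicEnergy = E₀`); no stub is stated for non-minimisers. (c)
`puffFloor_false_for_nearMinimisers` — no stub weakens minimality to an energy window; energies enter
only through the slope inequality, which bounds the pair functional `P`, never the floor itself.
(b)/(f) `puffFloor_tight_at_freeGas` / `puffFloor_holds_at_freeGas` (landed as
`Theorems/PuffFloor/Negative/FreeGasModel.lean`, not yet built on the farm at authoring time, hence not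
imported) — `v ≡ 0` has `v 0 = 0`: it is in S7's branch, where `W ≡ 0`, `P = 0`, and S3/S4 give the floor
with `C = 12·C_E`-type constants; consistent. (d) Targets: none. The landed negative lemmas
`PuffFloorFalseWithoutMinimality` / `PuffFloorFalseForNearMinimisers` are imported below and no stub is an
instance of a refuted variant (checked: every stub about states keeps
`periodicEnergy v Ψ = periodicGroundStateEnergy …` verbatim).
-/

noncomputable section

namespace Summit.AtomisticToContinuum.BoseEinsteinCondensation.Cruxes.PuffFloor.CouplingSlopePocket

open MeasureTheory Filter
open scoped ENNReal NNReal BigOperators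
open Literature.MathematicalPhysics.QuantumManyBody.BoseGas
open Summit.AtomisticToContinuum.BoseEinsteinCondensation.Theses.BECConjugateDomination

set_option linter.unusedVariables false

/-! ## Negative knowledge imported (no stub below is an instance of these refuted variants) -/

example : ¬ Theorems.PuffFloor.Negative.PuffFloorWithoutMinimality :=
  Theorems.PuffFloor.Negative.puffFloor_false_without_minimality

example : ¬ Theorems.PuffFloor.Negative.PuffFloorNearMinimisers :=
  Theorems.PuffFloor.Negative.puffFloor_false_for_nearMinimisers

/-! ## S1 — classical stability of the pocket potential (Tier 1 of the card) -/

/-- **S1 `stub_pocketClassicalStability`.** For a smooth-class `v` with a positive soft core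
(`0 < v 0`) and range `R₀`, the Puff weight profile `W(r) = r² ‖D²ṽ(r e₀)‖` satisfies, for all
`0 < t ≤ t₁` and every configuration of any number `N` of points in `ℝ³`,
`t ∑_{i<j} W(|xᵢ-xⱼ|) ≤ ∑_{i<j} v(|xᵢ-xⱼ|) + B t² N` — i.e. the pocket potential `v − tW` is
classically stable (Lee 2009, Def. 2) with constant `B t²`. Why true: by the edge condition
`W(r) ≤ R₀² Cₑ √(v r)` for `r ≤ R₀` and `W(r) = 0` for `r > R₀`, so
`v − tW ≥ (√v − tR₀²Cₑ/2)² − t²R₀⁴Cₑ²/4 ≥ −D_t 1_{[0,R₀]}`, `D_t = t²R₀⁴Cₑ²/4`, and `v − tW ≥ v/2 ≥ v₀/4`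
on the core `[0,r₁)` (where `v ≥ v₀/2`, `v₀ = v(0) > 0`, `ṽ` continuous) once `t ≤ √(v₀/2)/(2R₀²Cₑ)`;
tile `ℝ³` by half-open cubes of diameter `r₁`: `#{i<j : |xᵢⱼ| < r₁} ≥ ∑_c C(n_c,2)` and
`#{i<j : |xᵢⱼ| ≤ R₀} ≤ K ∑_c n_c² = K(2∑_c C(n_c,2) + N)` (`K` = number of cubes within `R₀` of a cube),
whence `∑(v−tW) ≥ (v₀/4 − 2D_tK)∑_c C(n_c,2) − D_tKN ≥ −(KR₀⁴Cₑ²/4) t² N` for `t ≤ t₁` small.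
Triage r1-2/3 re-derived it; toy j009977 shows 2–3 orders of room. Size: M (finite-sum bookkeeping over a
cube partition; the pointwise inequality is two lines). Source: card Tier 1; Ruelle 1969 §3.2. -/
theorem stub_pocketClassicalStability :
    ∀ v : ℝ → ℝ≥0∞, IsRepulsiveFiniteRange v → (∀ r, v r ≠ ⊤) →
      ContDiff ℝ 2 (fun x : Space => (v ‖x‖).toReal) →
      (∃ Cₑ : ℝ, ∀ x : Space, ‖iteratedFDeriv ℝ 2 (fun x : Space => (v ‖x‖).toReal) x‖
          ≤ Cₑ * Real.sqrt ((v ‖x‖).toReal)) →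
      0 < v 0 → ∀ R₀ : ℝ, 0 < R₀ → (∀ r, R₀ < r → v r = 0) →
      ∃ t₁ B : ℝ, 0 < t₁ ∧ 0 ≤ B ∧ ∀ t : ℝ, 0 < t → t ≤ t₁ → ∀ N : ℕ, ∀ X : Config N,
        ENNReal.ofReal t *
            interaction (fun r : ℝ => ENNReal.ofReal (r ^ 2 *
              ‖iteratedFDeriv ℝ 2 (fun x : Space => (v ‖x‖).toReal)
                (r • EuclideanSpace.single (0 : Fin 3) (1 : ℝ))‖)) X
          ≤ interaction v X + ENNReal.ofReal (B * t ^ 2 * N) := by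
  sorry

/-! ## S2 — no binding from classical stability (Lee 2009, Theorem 7) -/

/-- **S2 `stub_noBindingOfStability` (HARDEST real stub).** Lee 2009 (arXiv:0803.0533), Thm 7 with
`V₁ = ṽ` (continuous, compactly supported, `V₁(0) > 0`) and `V₂ = t₁ W̃`, `W̃(x) = |x|²‖D²ṽ(|x|e₀)‖`
(continuous, `≥ 0`, supported in `B_{R₀}`): if `V₁ − V₂` is classically stable
(`t₁ ∑_{i<j} W(|xᵢⱼ|) ≤ ∑_{i<j} v(|xᵢⱼ|) + BN` on every `ℝ³`-configuration), then there is `t₀ > 0`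
(`= c₁t₁`, `c₁ = (1 − √3R₀/ℓ)δ`, `δ = min{½, E′/6B}`) such that `H(v) − t₀∑W^per ≥ 0` as quadratic forms on
EVERY torus of side `L ≥ L₀` and for EVERY particle number: `t₀ ⟨Ψ, ∑_{i<j}W^per(xᵢ−xⱼ) Ψ⟩ ≤ ⟨Ψ, H Ψ⟩`.
Why true (pp. 5–7, no support separation is used — triage r1-1/2/3): Lemma 9 (`E(2,S,V₁) ≥ E′ > 0` on
every rectangular `S ⊂ Λ_ℓ` by Dyson's lemma on the shifted core `(ṽ − v₀/2)1_{B_R}` — tree: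
`LSSY2005_dysonBound_boxN_holds`; superadditivity `E(k,S,V₁) ≥ ⌊k/2⌋E′` — tree:
`LSSY2005_superadditivity_holds`; interpolation `T + ∑(V₁−δV₂) ≥ (1−δ)kE′/3 − δBk ≥ 0`), then Lemma 11 /
Thm 7 (sliding average of Neumann cell decompositions on the torus, `V₁ ≥ V₁h_ℓ`, `c₁V₂ ≤ δV₂h_ℓ` — tree:
`sum_neumannGroundStateEnergy_mul_le_setLIntegral_cellSet`, `PeriodicTrialState.toNeumann`,
`neumannEnergy_toNeumann_le`). Take `L₀ ≥ 2ℓ` and `ℓ := L/⌊L/ℓ₀⌋ ∈ [ℓ₀, 2ℓ₀)` to make the division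
integral; for `L ≥ L₀ > 2R₀` the periodised potentials are nearest-image (`periodizedPotential_eq_of_abs_lt`).
Our infimum runs over the `C¹` periodic Bose class ⊂ Lee's form domain, so his `E ≥ 0` implies ours.
`N = 0, 1`: no pairs, `0 ≤ periodicEnergy`. This is the card's Tier-2 anchor `PocketNoBinding` (C⁺ of its
Transfer) with its hypothesis made explicit; equivalently card `lee-stability-pair-domination`'s
`ClosePairDomination` restricted to the weight `W ≤ R₀²M₂ 1_{B_{R₀}}`. Size: L. Source: Lee2009 = arXiv:0803.0533, Thm 7 (pp. 5–7). -/
theorem stub_noBindingOfStability :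
    ∀ v : ℝ → ℝ≥0∞, IsRepulsiveFiniteRange v → (∀ r, v r ≠ ⊤) →
      ContDiff ℝ 2 (fun x : Space => (v ‖x‖).toReal) →
      (∃ Cₑ : ℝ, ∀ x : Space, ‖iteratedFDeriv ℝ 2 (fun x : Space => (v ‖x‖).toReal) x‖
          ≤ Cₑ * Real.sqrt ((v ‖x‖).toReal)) →
      0 < v 0 → ∀ R₀ : ℝ, 0 < R₀ → (∀ r, R₀ < r → v r = 0) →
      ∀ t₁ B : ℝ, 0 < t₁ →
        (∀ N : ℕ, ∀ X : Config N,
          ENNReal.ofReal t₁ *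
              interaction (fun r : ℝ => ENNReal.ofReal (r ^ 2 *
                ‖iteratedFDeriv ℝ 2 (fun x : Space => (v ‖x‖).toReal)
                  (r • EuclideanSpace.single (0 : Fin 3) (1 : ℝ))‖)) X
            ≤ interaction v X + ENNReal.ofReal (B * N)) →
        ∃ t₀ L₀ : ℝ, 0 < t₀ ∧ 0 < L₀ ∧ ∀ N : ℕ, ∀ L : ℝ, L₀ ≤ L → ∀ Ψ : PeriodicTrialState N L,
          ENNReal.ofReal t₀ *
              (∫⁻ X in cellN N L,
                periodicInteraction (fun r : ℝ => ENNReal.ofReal (r ^ 2 *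
                  ‖iteratedFDeriv ℝ 2 (fun x : Space => (v ‖x‖).toReal)
                    (r • EuclideanSpace.single (0 : Fin 3) (1 : ℝ))‖)) L X *
                  (‖Ψ.ψ X‖₊ : ℝ≥0∞) ^ 2)
            ≤ periodicEnergy v Ψ := by
  sorry

/-! ## S3 — the Born (constant trial state) upper bound, PROVED (ported from the
`sacrificial-edge-layer` skeleton of planner-cruxplan-…-sacrificial-edge-lay-0, same crux) -/

section EnergyUpperBound

variable {v : ℝ → ℝ≥0∞}

/-- Measurability of the periodised potential. [folklore] -/
theorem measurable_periodizedPotential' (hv : Measurable v) (L : ℝ) :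
    Measurable (periodizedPotential v L) := by
  unfold periodizedPotential
  exact Measurable.tsum fun n => hv.comp (measurable_id.sub_const _).norm

/-- `∫_{cell^{n+1}} v^per(xᵢ - xⱼ) dX = (∫_{ℝ³} v(|x|)dx) · L^{3n}` for `i ≠ j` (slice integration in
`xᵢ`, unfolding of the periodisation on the cell). [folklore] -/
theorem lintegral_cellN_periodizedPotential_pair (hv : Measurable v) {L : ℝ} (hL : 0 < L) {n : ℕ}
    {i j : Fin (n + 1)} (hij : i ≠ j) :
    ∫⁻ X in cellN (n + 1) L, periodizedPotential v L (X i - X j) =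
      (∫⁻ x : Space, v ‖x‖) * (ENNReal.ofReal L ^ 3) ^ n := by
  have hH : Measurable fun X : Config (n + 1) => periodizedPotential v L (X i - X j) :=
    (measurable_periodizedPotential' hv L).comp ((measurable_pi_apply i).sub (measurable_pi_apply j))
  have key := lintegral_cellN_lintegral_update (L := L) i hH
  have hinner : ∀ X : Config (n + 1),
      (∫⁻ x in cell L, periodizedPotential v L (Function.update X i x i - Function.update X i x j)) =
        ∫⁻ y : Space, v ‖y‖ := by
    intro X
    simp only [Function.update_self, Function.update_of_ne hij.symm]
    exact lintegral_cell_periodizedPotential_sub hL hv (X j)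
  simp only [hinner] at key
  rw [setLIntegral_const, volume_cellN, pow_succ, ← mul_assoc] at key
  have hV0 : (ENNReal.ofReal L ^ 3) ≠ 0 := pow_ne_zero _ ((ENNReal.ofReal_pos.2 hL).ne')
  have hVt : (ENNReal.ofReal L ^ 3) ≠ ⊤ := ENNReal.pow_ne_top ENNReal.ofReal_ne_top
  have key' : (ENNReal.ofReal L ^ 3) * ((∫⁻ y : Space, v ‖y‖) * (ENNReal.ofReal L ^ 3) ^ n) =
      (ENNReal.ofReal L ^ 3) * ∫⁻ X in cellN (n + 1) L, periodizedPotential v L (X i - X j) := by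
    rw [← key]; ring
  exact ((ENNReal.mul_right_inj hV0 hVt).1 key').symm

/-- **`E₀^per(n+1, L) ≤ ((n+1)²/L³) ∫_{ℝ³} v(|x|)dx`** by the constant trial state `Φ ≡ L^{-3(n+1)/2}`
(zero kinetic energy; each of the `≤ (n+1)²` pair terms costs `L⁻³∫ṽ`). [folklore] -/
theorem periodicGroundStateEnergy_le_const (hv : Measurable v) (n : ℕ) {L : ℝ} (hL : 0 < L) :
    periodicGroundStateEnergy v (n + 1) L ≤
      ENNReal.ofReal (((n : ℝ) + 1) ^ 2 / L ^ 3) * ∫⁻ x : Space, v ‖x‖ := by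
  set A : ℝ := (L ^ 3) ^ (n + 1) with hA
  have hLne : L ≠ 0 := hL.ne'
  have hL3 : 0 < L ^ 3 := by positivity
  have hApos : 0 < A := by positivity
  set c : ℝ := (Real.sqrt A)⁻¹ with hcdef
  have hc : ((‖(c : ℂ)‖₊ : ℝ≥0∞) ^ 2) = ENNReal.ofReal A⁻¹ := by
    rw [← ENNReal.coe_pow, ENNReal.ofReal, ENNReal.coe_inj]
    ext
    rw [NNReal.coe_pow, coe_nnnorm, Complex.norm_real, hcdef, norm_inv,
      Real.norm_of_nonneg (Real.sqrt_nonneg _), inv_pow, Real.sq_sqrt hApos.le,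
      Real.coe_toNNReal _ (by positivity)]
  have hvolA : (ENNReal.ofReal L ^ 3) ^ (n + 1) = ENNReal.ofReal A := by
    rw [hA, ← ENNReal.ofReal_pow hL.le, ← ENNReal.ofReal_pow hL3.le]
  let Φ : PeriodicTrialState (n + 1) L :=
    { ψ := fun _ => (c : ℂ)
      contDiff := contDiff_const
      periodic := fun _ _ _ => rfl
      symm := fun _ _ => rfl
      norm_eq := by
        rw [setLIntegral_const, volume_cellN, hc, hvolA, ← ENNReal.ofReal_mul (inv_nonneg.2 hApos.le),
          inv_mul_cancel₀ hApos.ne', ENNReal.ofReal_one] }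
  refine (periodicGroundStateEnergy_le v Φ).trans ?_
  have hkin : ∀ X : Config (n + 1), kineticDensity (fun _ : Config (n + 1) => (c : ℂ)) X = 0 := by
    intro X
    simp [kineticDensity]
  have hE : periodicEnergy v Φ =
      (∫⁻ X in cellN (n + 1) L, periodicInteraction v L X) * ENNReal.ofReal A⁻¹ := by
    unfold periodicEnergy
    rw [← lintegral_mul_const' _ _ ENNReal.ofReal_ne_top]
    refine lintegral_congr fun X => ?_
    change kineticDensity (fun _ : Config (n + 1) => (c : ℂ)) X +
        periodicInteraction v L X * ((‖(c : ℂ)‖₊ : ℝ≥0∞) ^ 2) = _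
    rw [hkin, zero_add, hc]
  set I : ℝ≥0∞ := ∫⁻ x : Space, v ‖x‖ with hI
  set V : ℝ≥0∞ := ENNReal.ofReal L ^ 3 with hV
  have hpair : ∀ i j : Fin (n + 1), i ≠ j →
      ∫⁻ X in cellN (n + 1) L, periodizedPotential v L (X i - X j) = I * V ^ n :=
    fun i j hij => lintegral_cellN_periodizedPotential_pair hv hL hij
  have hmeas : ∀ i j : Fin (n + 1),
      Measurable fun X : Config (n + 1) => periodizedPotential v L (X i - X j) := fun i j =>
    (measurable_periodizedPotential' hv L).comp ((measurable_pi_apply i).sub (measurable_pi_apply j))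
  have hint : (∫⁻ X in cellN (n + 1) L, periodicInteraction v L X) ≤
      ((n + 1 : ℕ) : ℝ≥0∞) * (((n + 1 : ℕ) : ℝ≥0∞) * (I * V ^ n)) := by
    unfold periodicInteraction
    rw [lintegral_finsetSum _ fun i _ => Finset.measurable_sum _ fun j _ => hmeas i j]
    have hrow : ∀ i : Fin (n + 1),
        (∫⁻ X in cellN (n + 1) L, ∑ j : Fin (n + 1) with i < j, periodizedPotential v L (X i - X j)) ≤
          ((n + 1 : ℕ) : ℝ≥0∞) * (I * V ^ n) := by
      intro i
      rw [lintegral_finsetSum _ fun j _ => hmeas i j]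
      have hterm : ∀ j ∈ (Finset.univ.filter fun j : Fin (n + 1) => i < j),
          (∫⁻ X in cellN (n + 1) L, periodizedPotential v L (X i - X j)) = I * V ^ n := by
        intro j hj
        exact hpair i j (Finset.mem_filter.1 hj).2.ne
      rw [Finset.sum_congr rfl hterm, Finset.sum_const, nsmul_eq_mul]
      gcongr
      exact_mod_cast (Finset.card_filter_le _ _).trans (by simp)
    calc (∑ i : Fin (n + 1), ∫⁻ X in cellN (n + 1) L,
            ∑ j : Fin (n + 1) with i < j, periodizedPotential v L (X i - X j))
        ≤ ∑ _i : Fin (n + 1), ((n + 1 : ℕ) : ℝ≥0∞) * (I * V ^ n) := Finset.sum_le_sum fun i _ => hrow i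
      _ = ((n + 1 : ℕ) : ℝ≥0∞) * (((n + 1 : ℕ) : ℝ≥0∞) * (I * V ^ n)) := by
          rw [Finset.sum_const, nsmul_eq_mul, Finset.card_univ, Fintype.card_fin]
  rw [hE]
  calc (∫⁻ X in cellN (n + 1) L, periodicInteraction v L X) * ENNReal.ofReal A⁻¹
      ≤ ((n + 1 : ℕ) : ℝ≥0∞) * (((n + 1 : ℕ) : ℝ≥0∞) * (I * V ^ n)) * ENNReal.ofReal A⁻¹ :=
        mul_le_mul' hint le_rfl
    _ = (((n + 1 : ℕ) : ℝ≥0∞) * ((n + 1 : ℕ) : ℝ≥0∞) * (V ^ n * ENNReal.ofReal A⁻¹)) * I := by ring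
    _ = ENNReal.ofReal (((n : ℝ) + 1) ^ 2 / L ^ 3) * I := by
        congr 1
        rw [hV, ← ENNReal.ofReal_pow hL.le, ← ENNReal.ofReal_pow hL3.le,
          ← ENNReal.ofReal_mul (by positivity), ← ENNReal.ofReal_natCast,
          ← ENNReal.ofReal_mul (by positivity), ← ENNReal.ofReal_mul (by positivity)]
        congr 1
        rw [hA]
        push_cast
        field_simp
        ring

/-- For a finite smooth potential of finite range, `∫_{ℝ³} v(|x|) dx < ∞`. [folklore] -/
theorem lintegral_lt_top_of_smooth (hv : IsRepulsiveFiniteRange v) (hfin : ∀ r, v r ≠ ⊤)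
    (hC : ContDiff ℝ 2 (fun x : Space => (v ‖x‖).toReal)) : (∫⁻ x : Space, v ‖x‖) < ⊤ := by
  obtain ⟨R₀, hR₀⟩ := hv.2
  set f : Space → ℝ := fun x => (v ‖x‖).toReal with hf
  have hfc : Continuous f := hC.continuous
  have hfs : HasCompactSupport f := by
    refine HasCompactSupport.intro (isCompact_closedBall (0 : Space) R₀) fun x hx => ?_
    have hx' : R₀ < ‖x‖ := by
      rw [Metric.mem_closedBall, dist_zero_right] at hx
      exact lt_of_not_ge hx
    simp [hf, hR₀ _ hx']
  have hint : Integrable f volume := hfc.integrable_of_hasCompactSupport hfs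
  have h0 : ∀ x, 0 ≤ f x := fun x => ENNReal.toReal_nonneg
  calc (∫⁻ x : Space, v ‖x‖) = ∫⁻ x : Space, ‖f x‖ₑ := by
        refine lintegral_congr fun x => ?_
        rw [Real.enorm_eq_ofReal (h0 x)]
        simp only [hf]
        rw [ENNReal.ofReal_toReal (hfin _)]
    _ < ⊤ := hint.2

end EnergyUpperBound

/-- **S3 (formerly `stub_bornEnergyBound`, now PROVED).** For a finite smooth finite-range `v` there is
`C_E ≥ 0` (namely `C_E = ‖ṽ‖₁ = ∫_{ℝ³} v(|x|)dx < ∞`) with `E₀^per(n+1, L) ≤ C_E (n+1)²/L³` for every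
`n` and every `L > 0`: the constant trial state. LSSY2005 Ch. 2 (after (2.8)). -/
theorem bornEnergyBound :
    ∀ v : ℝ → ℝ≥0∞, IsRepulsiveFiniteRange v → (∀ r, v r ≠ ⊤) →
      ContDiff ℝ 2 (fun x : Space => (v ‖x‖).toReal) →
      ∃ C_E : ℝ, 0 ≤ C_E ∧ ∀ n : ℕ, ∀ L : ℝ, 0 < L →
        periodicGroundStateEnergy v (n + 1) L ≤
          ENNReal.ofReal (C_E * (((n + 1 : ℕ) : ℝ)) ^ 2 / L ^ 3) := by
  intro v hv hfin hC2
  have hItop : (∫⁻ x : Space, v ‖x‖) ≠ ⊤ := (lintegral_lt_top_of_smooth hv hfin hC2).ne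
  refine ⟨(∫⁻ x : Space, v ‖x‖).toReal, ENNReal.toReal_nonneg, fun n L hL => ?_⟩
  refine (periodicGroundStateEnergy_le_const hv.1 n hL).trans (le_of_eq ?_)
  rw [← ENNReal.ofReal_toReal hItop, ← ENNReal.ofReal_mul (by positivity), ENNReal.ofReal_toReal hItop]
  congr 1
  push_cast
  ring

/-! ## S4a — the Euler–Lagrange (eigenvalue) equation of an exact `C³` minimiser -/

/-- **S4a `stub_eulerLagrange`.** A `C³` exact minimiser `Ψ` of the periodic `(n+1)`-body energy (finite
`C²` finite-range `v`, torus of side `L > 0`, finite energy) satisfies the eigenvalue equation POINTWISE: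
`-ΔΨ(X) + V^per(X) Ψ(X) = E₀ Ψ(X)` for every `X` (stated for `L > 2R₀`, `R₀` a range of `v`, so that
`V^per` is the nearest-image potential, `periodizedPotential_eq_of_abs_lt`), where `ΔΨ = ∑ᵢ ∑ₐ ∂²_{x_{i,a}} Ψ` (iterated directional
Fréchet derivatives along the coordinate axes), `V^per = periodicInteraction v L` (finite: finitely many
lattice images meet the range) and `E₀ = periodicGroundStateEnergy v (n+1) L` (finite, `≤` the energy of
the constant state). Why true: first variation of `periodicEnergy` at the minimiser inside the class
(`(Ψ + εη)/‖Ψ + εη‖` is an admissible periodic trial state for every symmetric periodic `C¹` `η`; the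
symmetry restriction is removed by symmetrising `η`, as `Ψ` and `V^per` are symmetric) gives the WEAK
equation `Re∫_{cell}(∇Ψ·∇η̄ + V^perΨη̄) = E₀ Re∫Ψη̄`; one integration by parts on the torus (`Ψ ∈ C²`,
periodicity kills boundary terms: `integral_cell_fderiv_eq_zero` pattern) and the test function
`η := -ΔΨ + V^perΨ − E₀Ψ` itself (it is `C¹`, periodic, symmetric because `Ψ ∈ C³` and `V^per ∈ C²` is a
locally finite lattice sum) give `∫|η|² = 0`, hence `η ≡ 0` by continuity. `n = 0`: `Ψ` is constant
(zero kinetic energy) and both sides vanish. Size: M–L. Sources: ReedSimonIV1978 §XIII.11–12; LSSY2005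
Ch. 2 (2.1); GilbargTrudinger2001 §8.1 (weak → strong for `C²` solutions). -/
theorem stub_eulerLagrange :
    ∀ v : ℝ → ℝ≥0∞, IsRepulsiveFiniteRange v → (∀ r, v r ≠ ⊤) →
      ContDiff ℝ 2 (fun x : Space => (v ‖x‖).toReal) →
      ∀ R₀ : ℝ, 0 < R₀ → (∀ r, R₀ < r → v r = 0) →
      ∀ n : ℕ, ∀ L : ℝ, 0 < L → 2 * R₀ < L → ∀ Ψ : PeriodicTrialState (n + 1) L, ContDiff ℝ 3 Ψ.ψ →
        periodicEnergy v Ψ = periodicGroundStateEnergy v (n + 1) L → periodicEnergy v Ψ ≠ ⊤ →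
        ∀ X : Config (n + 1),
          -(∑ i : Fin (n + 1), ∑ a : Fin 3,
              fderiv ℝ (fun Y : Config (n + 1) =>
                  fderiv ℝ Ψ.ψ Y (Pi.single i (EuclideanSpace.single a (1 : ℝ)))) X
                (Pi.single i (EuclideanSpace.single a (1 : ℝ)))) +
            ((periodicInteraction v L X).toReal : ℂ) * Ψ.ψ X =
          ((periodicGroundStateEnergy v (n + 1) L).toReal : ℂ) * Ψ.ψ X := by
  sorry

/-! ## S4b — the Puff–Feynman floor (sum-rule engine, sharp real form, pure calculus given S4a) -/

/-- **S4b `stub_puffFeynmanFloor`.** The printed sum-rule chain, as ONE statement about a `C³`, real,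
nowhere-vanishing exact minimiser `Ψ` of the periodic `(n+1)`-body energy (torus of side `L > 0`, finite
`C²` finite-range `v`) that satisfies the eigenvalue equation pointwise (the conclusion of S4a, taken as a
HYPOTHESIS here so that this stub is pure calculus + the variational principle): there are universal
numerical constants `c₁, c₂ ≥ 0` (Puff's: `c₁ = 12`, `c₂ = 2`) such that, if Puff's parameter is at most
`Θ`, i.e. `c₁·T + c₂·P ≤ Θ·(n+1)` with `T = ∫_{cell^N}|∇Ψ|²` and `P = ∫_{cell^N} ∑_{i<j} W^per(xᵢ−xⱼ)|Ψ|²`,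
`W(r) = r²‖D²ṽ(r e₀)‖`, then `S_m ≥ |k|/√(|k|² + Θ)` for every `m ≠ 0`, `k = (2π/L)m`,
`S_m = (n+1)⁻¹∫|∑ⱼ e_m(xⱼ)|²|Ψ|²`. Why true (Puff1965; Stringari1995 §2.3 (20)–(23); re-derived by triage
and for the sibling support stmt-12618 `CurrentSumRule`, whose `M₃` is the same): with
`G = ρ_k = ∑ⱼ e_m(xⱼ)`, `A := ∑ⱼ e_m(xⱼ)(|k|²Ψ − 2i(k·∇ⱼ)Ψ) ∈ C²` (`= (H − E₀)(GΨ)` by the equation) and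
`q(φ) = ∫_{cell}(|∇φ|² + V^per|φ|²) − E₀∫|φ|² ≥ 0` on symmetric periodic `C¹` `φ` (variational principle,
i.e. minimality; `φ/‖φ‖` is a trial state): (1) `q(GΨ, χ) = Re⟨A, χ⟩` for periodic `C¹` `χ` (one
integration by parts + the equation), so `m₁ := q(GΨ) = Re⟨A, GΨ⟩ = ∫|∇G|²Ψ² = (n+1)|k|²` (f-sum rule,
`groundStateDirichletForm_planeWaveSum`) and Cauchy–Schwarz in `L²`: `m₁² ≤ m₀ m₂`, `m₀ = ‖GΨ‖² = (n+1)S_m`,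
`m₂ = ‖A‖²`; (2) `m₂ = q(GΨ, A) ≤ √(q(GΨ) q(A))` (Cauchy–Schwarz for the non-negative form `q`), so
`m₁³ ≤ m₀² q(A)`; (3) Puff's evaluation (ground-state representation `q(FΨ) = ∫Ψ²|∇F|²`, `F = A/Ψ`,
`Ψ > 0`, `Ψ ∈ C³`, two more integrations by parts and the equation in the form
`∑ₗ(Δₗ log Ψ + |∇ₗ log Ψ|²) = V^per − E₀`): `q(A) = (n+1)|k|⁶ + 12|k|²∑ⱼ‖(k·∇ⱼ)Ψ‖² +
4 E_Ψ[∑_{i<j}(1 − cos k·(xᵢ−xⱼ)) (k·∇)²V^per_{ij}] ≤ (n+1)|k|⁴(|k|² + (12T + 2P)/(n+1))`, using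
`‖(k·∇ⱼ)Ψ‖² ≤ |k|²‖∇ⱼΨ‖²`, `1 − cos(k·(x−Lq)) ≤ |k|²|x−Lq|²/2` image by image (`k·Lq ∈ 2πℤ`) and
`|(k·∇)²ṽ(y)| ≤ |k|²‖D²ṽ(y)‖ = |k|²‖D²ṽ(|y|e₀)‖` (rotation invariance of the Hessian norm of the radial `ṽ`:
`LinearIsometryEquiv` + `ContinuousMultilinearMap.norm_compContinuous_linearIsometryEquiv`);
(4) algebra: `S_m² ≥ |k|⁶/(|k|⁴(|k|²+Θ))`. One-particle check of the constant `12 = 4 + 8`: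
`q(A) = k⁶ + 12k²‖∂_kΨ‖² + 2⟨(k·∇)²U⟩` for `−Δ + U`. Integration by parts on `cell^N` for periodic `C¹`
data: `integral_cell_fderiv_eq_zero` (one particle; extend by `lintegral_cellN_lintegral_update`-type
slicing), cf. `integral_cellN_fderiv_single_eq_zero` in Cruxes/InfraredMinimumUncertainty/Lines/
fisher-gaussian-density-mode.lean (copy, do not import). Tree: `groundStateDirichletForm_planeWaveSum`,
`kineticDensity_planeWaveSum`, `planeWaveSum_eq_densityWave`, cell Fourier toolkit (`cellWave_apply`,
`fderiv_cellWave_apply_single`, `norm_cellWave`), `Theorems/PuffFloor/Negative/PairCorrelationToolkit`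
(`normSq_planeWaveSum`, `integral_cellN_pairWave`). Size: L–XL (long but printed line by line).
Sources: Puff1965; Stringari1995 §2.3 (20)–(23) (held in book:griffin1995-bose-einstein-condensation,
PDF p. 77); Lipparini2008 (8.64), (8.66), (10.80). -/
theorem stub_puffFeynmanFloor :
    ∃ c₁ c₂ : ℝ, 0 ≤ c₁ ∧ 0 ≤ c₂ ∧
    ∀ v : ℝ → ℝ≥0∞, IsRepulsiveFiniteRange v → (∀ r, v r ≠ ⊤) →
      ContDiff ℝ 2 (fun x : Space => (v ‖x‖).toReal) →
      ∀ R₀ : ℝ, 0 < R₀ → (∀ r, R₀ < r → v r = 0) →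
      ∀ n : ℕ, ∀ L : ℝ, 0 < L → 2 * R₀ < L → ∀ Ψ : PeriodicTrialState (n + 1) L, ContDiff ℝ 3 Ψ.ψ →
        periodicEnergy v Ψ = periodicGroundStateEnergy v (n + 1) L → periodicEnergy v Ψ ≠ ⊤ →
        (∀ X, Ψ.ψ X = (‖Ψ.ψ X‖ : ℂ)) → (∀ X, Ψ.ψ X ≠ 0) →
        (∀ X : Config (n + 1),
          -(∑ i : Fin (n + 1), ∑ a : Fin 3,
              fderiv ℝ (fun Y : Config (n + 1) =>
                  fderiv ℝ Ψ.ψ Y (Pi.single i (EuclideanSpace.single a (1 : ℝ)))) X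
                (Pi.single i (EuclideanSpace.single a (1 : ℝ)))) +
            ((periodicInteraction v L X).toReal : ℂ) * Ψ.ψ X =
          ((periodicGroundStateEnergy v (n + 1) L).toReal : ℂ) * Ψ.ψ X) →
        ∀ Θ : ℝ, 0 ≤ Θ →
          ENNReal.ofReal c₁ * (∫⁻ X in cellN (n + 1) L, kineticDensity Ψ.ψ X) +
              ENNReal.ofReal c₂ * (∫⁻ X in cellN (n + 1) L,
                periodicInteraction (fun r : ℝ => ENNReal.ofReal (r ^ 2 *
                  ‖iteratedFDeriv ℝ 2 (fun x : Space => (v ‖x‖).toReal)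
                    (r • EuclideanSpace.single (0 : Fin 3) (1 : ℝ))‖)) L X *
                  (‖Ψ.ψ X‖₊ : ℝ≥0∞) ^ 2)
            ≤ ENNReal.ofReal (Θ * ((n : ℝ) + 1)) →
          ∀ m : Fin 3 → ℤ, m ≠ 0 →
            ‖(2 * Real.pi / L) • latticeVec 1 m‖ /
                Real.sqrt (‖(2 * Real.pi / L) • latticeVec 1 m‖ ^ 2 + Θ)
              ≤ ((n : ℝ) + 1)⁻¹ *
                  ∫ X in cellN (n + 1) L, ‖∑ j : Fin (n + 1), cellWave L m (X j)‖ ^ 2 * ‖Ψ.ψ X‖ ^ 2 := by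
  sorry

/-! ## S5 — a `C³` positive minimiser exists (route support item stmt-11787, BY NAME) -/

/-- **S5 `stub_positiveMinimiser`.** The route's support item `PositiveMinimiser`
(stmt-AtomisticToContinuum-11787) verbatim, by name: for every smooth-class `v`, every `n` and `L > 0` the
periodic `(n+1)`-body energy has a minimiser in the `C¹` periodic Bose class which is `C³`, of finite
energy, and pointwise strictly positive (`Ψ = |Ψ| ≠ 0`). Why true: compact resolvent on the torus, bosonic
ground state = absolute ground state, Perron–Frobenius / positivity improvement, Schauder `C^{3,α}`
regularity for `V ∈ C²` (Reed–Simon XIII.43–47; LSSY2005). It is needed because S4 wants `C³` and the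
crux quantifies over `C¹` minimisers (triage F2/S2); S6 transports the floor. A proof lands BOTH as this
stub (`--supports stmt-…-11785`) and as the item (`--workitem stmt-AtomisticToContinuum-11787`).
Size: L. Sources: ReedSimonIV1978 §XIII.12 (Thms XIII.43–47); LSSY2005. -/
theorem stub_positiveMinimiser : PositiveMinimiser := by
  sorry

/-! ## S6 — uniqueness of the positive minimiser (transport from `C³` to the crux's `C¹` minimiser) -/

/-- **S6 `stub_positiveMinimiserUnique`.** On the torus of side `L > 0`, two exact minimisers of the
periodic `(n+1)`-body energy (measurable `v`, finite ground-state energy) that are both real non-negative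
and nowhere zero coincide. Why true (elementary, `C¹` suffices — no spectral theory): with `ρᵢ = Ψᵢ²`,
`Φ = √((ρ₁+ρ₂)/2)` is an admissible state (`C¹` since `ρ₁+ρ₂ > 0`, periodic, symmetric, normalised) and
pointwise `½|∇Ψ₁|² + ½|∇Ψ₂|² − |∇Φ|² = |Ψ₂∇Ψ₁ − Ψ₁∇Ψ₂|²/(2(Ψ₁²+Ψ₂²)) ≥ 0` (Lagrange identity; convexity
of `ρ ↦ |∇√ρ|²`), the potential term being affine in `ρ`; so `E₀ ≤ E[Φ] = E₀ − ∫ defect`, the continuous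
non-negative defect vanishes on the open box `(0,L)^{3N}`, i.e. `∇(Ψ₁/Ψ₂) = 0` there, `Ψ₁ = cΨ₂` on the
open box (convex; mean value theorem), on the cell by continuity along the inward diagonal and everywhere
by periodicity (exactly the technique of `Theorems/PuffFloor/Negative/FreeGasModel.exists_eq_const_of_kinetic_zero`),
and `c = 1` by normalisation and positivity; structure equality from `ψ` equality (the other fields are
`Prop`s). Size: M. Source: the convexity-of-`ρ ↦ ∫|∇√ρ|²` uniqueness argument behind LSSY2005 Ch. 6
Thm 6.1 ("unique, positive φ^GP", after [LSeY1] §2 / App. A); here at fixed `N` for the linear problem. -/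
theorem stub_positiveMinimiserUnique :
    ∀ v : ℝ → ℝ≥0∞, Measurable v → ∀ n : ℕ, ∀ L : ℝ, 0 < L →
      ∀ Ψ₁ Ψ₂ : PeriodicTrialState (n + 1) L,
        periodicEnergy v Ψ₁ = periodicGroundStateEnergy v (n + 1) L → periodicEnergy v Ψ₁ ≠ ⊤ →
        (∀ X, Ψ₁.ψ X = (‖Ψ₁.ψ X‖ : ℂ)) → (∀ X, Ψ₁.ψ X ≠ 0) →
        periodicEnergy v Ψ₂ = periodicGroundStateEnergy v (n + 1) L →
        (∀ X, Ψ₂.ψ X = (‖Ψ₂.ψ X‖ : ℂ)) → (∀ X, Ψ₂.ψ X ≠ 0) →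
        Ψ₁ = Ψ₂ := by
  sorry

/-! ## S7 — the scope residual: coreless smooth-class potentials (`v 0 = 0`) -/

/-- **S7 `stub_corelessPairMoment` (SCOPE RESIDUAL — read the warning).** For a smooth-class `v` WITHOUT a
positive core (`v 0 = 0`: e.g. `v ≡ 0`, hollow shells `A(|x|²−r₁²)₊⁴(R₀²−|x|²)₊⁴`, `A|x|⁴(R₀²−|x|²)₊⁴` — all
admitted by the crux's class, since `IsRepulsiveFiniteRange` has no monotonicity) the Puff pair functional of
the positive minimiser is `O(ρN)`: `P(Ψ) = ∫∑_{i<j}W^per(xᵢ−xⱼ)|Ψ|² ≤ C_P ρ (n+1)` eventually in `n`, for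
`ρ < ρ₁`. Why plausibly true: at low density `g₂ ≈ f₀²` with `f₀` the zero-energy scattering solution,
constant inside a hollow core and `≤ 1`, so `P ≈ ½Nρ∫W f₀² ≤ ½ρN R₀²M₂|B_{R₀}|`; `v ≡ 0` gives `W ≡ 0`,
`P = 0`. Why it is the residual: for coreless `v` the comparison Hamiltonian `H(v) − t∑W` is catastrophic
(clumps inside the zero set: `inf spec ≤ −ct²m·N`, card §(iii), toy j009977: `E/N = −1.0 → −4.1` for
`m = 10 → 40`), so S1/S2 — and every energy-comparison or operator-domination lever of the three passing
lines — are void there; no mechanism is on file (triage r1-1 §1, r1-2 F1, r1-3 S1: "proof gap, not a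
falsity finding", consistent with Disproof (e)). RECOMMENDED DISPOSITION (lead → tenure planner): restate
the route's smooth class with `0 < v 0` in `PuffFloor` (and IMU / supports / the hypothesis of
`HardCoreExtension`, physically immaterial); then delete S7 and the `by_cases` in `PuffFloor_of`. Until then
this stub is what separates the line from the crux AS TYPED. Size: open (XL). -/
theorem stub_corelessPairMoment :
    ∀ v : ℝ → ℝ≥0∞, IsRepulsiveFiniteRange v → (∀ r, v r ≠ ⊤) →
      ContDiff ℝ 2 (fun x : Space => (v ‖x‖).toReal) →
      (∃ Cₑ : ℝ, ∀ x : Space, ‖iteratedFDeriv ℝ 2 (fun x : Space => (v ‖x‖).toReal) x‖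
          ≤ Cₑ * Real.sqrt ((v ‖x‖).toReal)) →
      v 0 = 0 →
      ∃ C_P : ℝ, 0 ≤ C_P ∧ ∃ ρ₁ : ℝ, 0 < ρ₁ ∧ ∀ ρ : ℝ, 0 < ρ → ρ < ρ₁ → ∀ᶠ n : ℕ in atTop,
        ∀ Ψ : PeriodicTrialState (n + 1) (sideLength ρ (n + 1)), ContDiff ℝ 3 Ψ.ψ →
          periodicEnergy v Ψ = periodicGroundStateEnergy v (n + 1) (sideLength ρ (n + 1)) →
          periodicEnergy v Ψ ≠ ⊤ → (∀ X, Ψ.ψ X = (‖Ψ.ψ X‖ : ℂ)) → (∀ X, Ψ.ψ X ≠ 0) →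
          (∫⁻ X in cellN (n + 1) (sideLength ρ (n + 1)),
              periodicInteraction (fun r : ℝ => ENNReal.ofReal (r ^ 2 *
                ‖iteratedFDeriv ℝ 2 (fun x : Space => (v ‖x‖).toReal)
                  (r • EuclideanSpace.single (0 : Fin 3) (1 : ℝ))‖)) (sideLength ρ (n + 1)) X *
                (‖Ψ.ψ X‖₊ : ℝ≥0∞) ^ 2)
            ≤ ENNReal.ofReal (C_P * ρ * ((n : ℝ) + 1)) := by
  sorry

/-! ## Small proved helpers for the composition -/

/-- A finite-range potential has a POSITIVE range parameter. [folklore] -/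
theorem exists_pos_range {v : ℝ → ℝ≥0∞} (hv : IsRepulsiveFiniteRange v) :
    ∃ R₀ : ℝ, 0 < R₀ ∧ ∀ r, R₀ < r → v r = 0 := by
  obtain ⟨R, hR⟩ := hv.2
  refine ⟨max R 1, lt_max_of_lt_right one_pos, fun r hr => hR r ?_⟩
  exact lt_of_le_of_lt (le_max_left R 1) hr

/-- `L_{n+1}(ρ) = ((n+1)/ρ)^{1/3} > 0`. [folklore] -/
theorem sideLength_succ_pos {ρ : ℝ} (hρ : 0 < ρ) (n : ℕ) : 0 < sideLength ρ (n + 1) := by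
  unfold sideLength
  apply Real.rpow_pos_of_pos
  positivity

/-- `L_{n+1}(ρ) → ∞`. [folklore] -/
theorem tendsto_sideLength_succ {ρ : ℝ} (hρ : 0 < ρ) :
    Tendsto (fun n : ℕ => sideLength ρ (n + 1)) atTop atTop := by
  have h : Tendsto (fun N : ℕ => sideLength ρ N) atTop atTop :=
    (tendsto_rpow_atTop (by norm_num : (0 : ℝ) < 1 / 3)).comp
      (tendsto_natCast_atTop_atTop.atTop_div_const hρ)
  exact h.comp (tendsto_add_atTop_nat 1)

/-- At `L = L_{n+1}(ρ)`: `C (n+1)² / L³ = C ρ (n+1)`. [folklore] -/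
theorem const_mul_sq_div_sideLength_cube {ρ : ℝ} (hρ : 0 < ρ) (C : ℝ) (n : ℕ) :
    C * ((n + 1 : ℕ) : ℝ) ^ 2 / sideLength ρ (n + 1) ^ 3 = C * ρ * ((n : ℝ) + 1) := by
  have h := div_sideLength_pow_three hρ (Nat.succ_pos n : 0 < n + 1)
  have hL : sideLength ρ (n + 1) ^ 3 ≠ 0 := ne_of_gt (pow_pos (sideLength_succ_pos hρ n) 3)
  rw [div_eq_iff hL] at h
  rw [div_eq_iff hL]
  push_cast at h ⊢
  calc C * ((n : ℝ) + 1) ^ 2 = C * ((n : ℝ) + 1) * (ρ * sideLength ρ (n + 1) ^ 3) := by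
        rw [← h]; ring
    _ = C * ρ * ((n : ℝ) + 1) * sideLength ρ (n + 1) ^ 3 := by ring

/-- `ENNReal` bookkeeping: from `a ≤ ofReal x` and `b ≤ ofReal y` (`x, y, c₁, c₂ ≥ 0`),
`ofReal c₁ · a + ofReal c₂ · b ≤ ofReal (c₁ x + c₂ y)`. [folklore] -/
theorem weighted_add_le {a b : ℝ≥0∞} {x y c₁ c₂ : ℝ} (hx : 0 ≤ x) (hy : 0 ≤ y)
    (hc₁ : 0 ≤ c₁) (hc₂ : 0 ≤ c₂)
    (ha : a ≤ ENNReal.ofReal x) (hb : b ≤ ENNReal.ofReal y) :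
    ENNReal.ofReal c₁ * a + ENNReal.ofReal c₂ * b ≤ ENNReal.ofReal (c₁ * x + c₂ * y) := by
  rw [ENNReal.ofReal_add (by positivity) (by positivity), ENNReal.ofReal_mul hc₁,
    ENNReal.ofReal_mul hc₂]
  gcongr

/-- `ENNReal` bookkeeping of the slope step: `t·P ≤ E ≤ ofReal c` with `t > 0` gives `P ≤ ofReal (c/t)`.
[folklore] -/
theorem le_ofReal_div_of_mul_le {t c : ℝ} (ht : 0 < t) (hc : 0 ≤ c) {P E : ℝ≥0∞}
    (h : ENNReal.ofReal t * P ≤ E) (hE : E ≤ ENNReal.ofReal c) :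
    P ≤ ENNReal.ofReal (c / t) := by
  rw [ENNReal.ofReal_div_of_pos ht]
  have ht0 : ENNReal.ofReal t ≠ 0 := by
    rw [ENNReal.ofReal_ne_zero_iff]; exact ht
  refine (ENNReal.le_div_iff_mul_le (Or.inl ht0) (Or.inl ENNReal.ofReal_ne_top)).2 ?_
  rw [mul_comm]
  exact h.trans hE

/-! ## The slope step: S1 + S2 give the card's `PocketNoBinding` (C⁺) for positive cores -/

/-- **`PocketNoBinding` for positive cores** (the card's Tier-2 anchor, C⁺ of its Transfer), PROVED
from S1 (classical stability at `t = t₁`) and S2 (Lee's theorem): `∃ t₀ L₀, ∀ N, ∀ L ≥ L₀, ∀ Ψ,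
t₀ ⟨Ψ, ∑W^per Ψ⟩ ≤ ⟨Ψ, H(v) Ψ⟩`. -/
theorem pairMoment_of_positiveCore
    (v : ℝ → ℝ≥0∞) (hv : IsRepulsiveFiniteRange v) (hfin : ∀ r, v r ≠ ⊤)
    (hC2 : ContDiff ℝ 2 (fun x : Space => (v ‖x‖).toReal))
    (hedge : ∃ Cₑ : ℝ, ∀ x : Space, ‖iteratedFDeriv ℝ 2 (fun x : Space => (v ‖x‖).toReal) x‖
        ≤ Cₑ * Real.sqrt ((v ‖x‖).toReal))
    (hcore : 0 < v 0) {R₀ : ℝ} (hR₀ : 0 < R₀) (hrange : ∀ r, R₀ < r → v r = 0) :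
    ∃ t₀ L₀ : ℝ, 0 < t₀ ∧ 0 < L₀ ∧ ∀ N : ℕ, ∀ L : ℝ, L₀ ≤ L → ∀ Ψ : PeriodicTrialState N L,
      ENNReal.ofReal t₀ *
          (∫⁻ X in cellN N L,
            periodicInteraction (fun r : ℝ => ENNReal.ofReal (r ^ 2 *
              ‖iteratedFDeriv ℝ 2 (fun x : Space => (v ‖x‖).toReal)
                (r • EuclideanSpace.single (0 : Fin 3) (1 : ℝ))‖)) L X *
              (‖Ψ.ψ X‖₊ : ℝ≥0∞) ^ 2)
        ≤ periodicEnergy v Ψ := by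
  obtain ⟨t₁, B, ht₁, hB, hstab⟩ :=
    stub_pocketClassicalStability v hv hfin hC2 hedge hcore R₀ hR₀ hrange
  exact stub_noBindingOfStability v hv hfin hC2 hedge hcore R₀ hR₀ hrange t₁ (B * t₁ ^ 2) ht₁
    (fun N X => hstab t₁ ht₁ le_rfl N X)

/-! ## The composition: the seven stubs (S3 proved) give the crux BY NAME -/

/-- **`PuffFloor` from the line `coupling-slope-pocket`** (kernel-checked, no `sorry` of its own).
For a smooth-class `v`: `bornEnergyBound` gives `C_E`; the pair-moment constant `C_P` comes from the
slope step (positive core: `pairMoment_of_positiveCore`, i.e. S1+S2, with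
`E(Ψ) = E₀ ≤ C_E(n+1)²/L³ = C_Eρ(n+1)` for `L = L_{n+1}(ρ) ≥ L₀`, eventually in `n`) or from S7
(coreless); with Puff's numerics `c₁, c₂` (S4b) and `C = c₁C_E + c₂C_P`, at any `ρ < ρ₁` and eventually
in `n`, the crux's minimiser `Ψ` equals the `C³` positive minimiser of S5 by S6, satisfies the eigenvalue
equation by S4a, and `T ≤ E(Ψ) = E₀ ≤ C_Eρ(n+1)` and the pair-moment bound feed S4b with `Θ = Cρ`. -/
theorem PuffFloor_of : PuffFloor := by
  intro v hv hfin hC2 hedge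
  obtain ⟨R₀, hR₀, hrange⟩ := exists_pos_range hv
  obtain ⟨CE, hCE0, hCE⟩ := bornEnergyBound v hv hfin hC2
  obtain ⟨c₁, c₂, hc₁, hc₂, hPuff⟩ := stub_puffFeynmanFloor
  -- the pair-moment bound for positive minimisers, eventually in `n`, in S7's currency
  have hPM : ∃ C_P : ℝ, 0 ≤ C_P ∧ ∃ ρ₁ : ℝ, 0 < ρ₁ ∧ ∀ ρ : ℝ, 0 < ρ → ρ < ρ₁ → ∀ᶠ n : ℕ in atTop,
      ∀ Ψ : PeriodicTrialState (n + 1) (sideLength ρ (n + 1)), ContDiff ℝ 3 Ψ.ψ →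
        periodicEnergy v Ψ = periodicGroundStateEnergy v (n + 1) (sideLength ρ (n + 1)) →
        periodicEnergy v Ψ ≠ ⊤ → (∀ X, Ψ.ψ X = (‖Ψ.ψ X‖ : ℂ)) → (∀ X, Ψ.ψ X ≠ 0) →
        (∫⁻ X in cellN (n + 1) (sideLength ρ (n + 1)),
            periodicInteraction (fun r : ℝ => ENNReal.ofReal (r ^ 2 *
              ‖iteratedFDeriv ℝ 2 (fun x : Space => (v ‖x‖).toReal)
                (r • EuclideanSpace.single (0 : Fin 3) (1 : ℝ))‖)) (sideLength ρ (n + 1)) X *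
              (‖Ψ.ψ X‖₊ : ℝ≥0∞) ^ 2)
          ≤ ENNReal.ofReal (C_P * ρ * ((n : ℝ) + 1)) := by
    by_cases hcore : 0 < v 0
    · obtain ⟨t₀, L₀, ht₀, hL₀, hNB⟩ :=
        pairMoment_of_positiveCore v hv hfin hC2 hedge hcore hR₀ hrange
      refine ⟨CE / t₀, div_nonneg hCE0 ht₀.le, 1, one_pos, fun ρ hρ _ => ?_⟩
      filter_upwards [(tendsto_sideLength_succ hρ).eventually_ge_atTop L₀] with n hn Ψ hC3 hmin
        hfinE hreal hne
      have hE : periodicEnergy v Ψ ≤ ENNReal.ofReal (CE * ρ * ((n : ℝ) + 1)) := by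
        rw [hmin, ← const_mul_sq_div_sideLength_cube hρ CE n]
        exact hCE n (sideLength ρ (n + 1)) (sideLength_succ_pos hρ n)
      have h := le_ofReal_div_of_mul_le ht₀ (by positivity) (hNB (n + 1) (sideLength ρ (n + 1)) hn Ψ) hE
      have hring : CE * ρ * ((n : ℝ) + 1) / t₀ = CE / t₀ * ρ * ((n : ℝ) + 1) := by ring
      rw [hring] at h
      exact h
    · have h0 : v 0 = 0 := le_antisymm (not_lt.1 hcore) bot_le
      exact stub_corelessPairMoment v hv hfin hC2 hedge h0
  obtain ⟨CP, hCP0, ρ₁, hρ₁, hP⟩ := hPM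
  refine ⟨c₁ * CE + c₂ * CP, by positivity, ρ₁, hρ₁, fun ρ hρ hρ₁' => ?_⟩
  filter_upwards [hP ρ hρ hρ₁',
    (tendsto_sideLength_succ hρ).eventually_gt_atTop (2 * R₀)] with n hn h2R₀ Ψ
  intro L S kn hmin hfinE hreal hne m hm
  have hLpos : 0 < sideLength ρ (n + 1) := sideLength_succ_pos hρ n
  -- the C³ positive minimiser and its identification with Ψ
  obtain ⟨Ψ₀, hmin₀, hfin₀, hC3₀, hreal₀, hne₀⟩ :=
    stub_positiveMinimiser v hv hfin hC2 hedge n (sideLength ρ (n + 1)) hLpos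
  have hΨ : Ψ = Ψ₀ :=
    stub_positiveMinimiserUnique v hv.1 n (sideLength ρ (n + 1)) hLpos Ψ Ψ₀ hmin hfinE hreal hne
      hmin₀ hreal₀ hne₀
  have hC3 : ContDiff ℝ 3 Ψ.ψ := by rw [hΨ]; exact hC3₀
  -- the eigenvalue equation of the exact minimiser
  have hEL := stub_eulerLagrange v hv hfin hC2 R₀ hR₀ hrange n (sideLength ρ (n + 1)) hLpos h2R₀ Ψ hC3
    hmin hfinE
  -- pair moment and kinetic energy are O(ρ N)
  have hPint := hn Ψ hC3 hmin hfinE hreal hne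
  have hE : periodicEnergy v Ψ ≤ ENNReal.ofReal (CE * ρ * ((n : ℝ) + 1)) := by
    rw [hmin, ← const_mul_sq_div_sideLength_cube hρ CE n]
    exact hCE n (sideLength ρ (n + 1)) hLpos
  have hT : (∫⁻ X in cellN (n + 1) (sideLength ρ (n + 1)), kineticDensity Ψ.ψ X)
      ≤ ENNReal.ofReal (CE * ρ * ((n : ℝ) + 1)) := by
    refine le_trans ?_ hE
    exact lintegral_mono fun X => le_self_add
  have key := weighted_add_le (by positivity) (by positivity) hc₁ hc₂ hT hPint
  have hring : c₁ * (CE * ρ * ((n : ℝ) + 1)) + c₂ * (CP * ρ * ((n : ℝ) + 1)) =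
      (c₁ * CE + c₂ * CP) * ρ * ((n : ℝ) + 1) := by ring
  rw [hring] at key
  exact hPuff v hv hfin hC2 R₀ hR₀ hrange n (sideLength ρ (n + 1)) hLpos h2R₀ Ψ hC3 hmin hfinE hreal hne
    hEL ((c₁ * CE + c₂ * CP) * ρ) (by positivity) key m hm

end Summit.AtomisticToContinuum.BoseEinsteinCondensation.Cruxes.PuffFloor.CouplingSlopePocket

end
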